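/-
Copyright (c) 2026 the pub-hodgecm-mathlib formalisation cell (harness21).  Prover seat hodgecm-mathlib-K2E4-p10 (g9), Track B «K2-LIT»,
#184♮ = hLiu418 = `stmt-HodgeConjecture-24832`; socket #41, KIND W, (x-b) of LEAD F0P6-plan (g14) BATCH #62 (1) + desk K2E5-p17 (g8) RULING 2026-09-04T22:15:21Z
(«(x-a) F0P2-p08: ∃-shaped continued `T`-part with a PER-PLACE PRESENTATION; (x-b) K2E4-p10: `hdec_of_local` ∕ `hsupp_of_local` hypothesis-first, ∃-packaging head LAST»).
THEOREMS ONLY (no `def`, no `instance`, no notation, no named-fact hypothesis, no `sorry`); Mathlib + ★ Literature `AdelicHeightGLProofs` only.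
-/
import Literature.NumberTheory.Automorphic.AdelicHeightGLProofs        -- ★ `adelicHeightGL`, `adelicHeightGL_pos_holds`
import Mathlib.Analysis.SpecialFunctions.Pow.Real
import Mathlib.NumberTheory.NumberField.CanonicalEmbedding.Basic
import Mathlib.NumberTheory.NumberField.Norm
import Mathlib.LinearAlgebra.Matrix.AbsoluteValue
import Mathlib.Analysis.Normed.Unbundled.RingSeminorm
import HarnessLib

/-!
# Crux `HLiu418`, socket #41, KIND W — `K2LiuSiegelEisensteinKindWDecay`: THE TOP's DECAY LETTER `hdec` FROM LOCAL LETTERS CARRYING THE ARCHIMEDEAN DETERMINANT DEFECT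

Cell `hodgecm-mathlib`, crux item hLiu418 = `stmt-HodgeConjecture-24832` (helper lane `--supports … --as helper`, count-neutral), route of record `HCCMUnconditional`;
squad K2 ∕ K2Liu, road `K2_Liu`, socket #41 `sig_K2LiuSiegelEisensteinContinuation`, KIND W.  Companion of ★ `K2LiuSiegelEisensteinKindWInstance` §1 (`hsupp_of_local`,
the SUPPORT letter :193–196 of the TOP ★ ed. 15 `K2LiuSiegelEisensteinContinuationTopFifteen`); this file assembles the DECAY letter `hdec` (:190–192):
  `∀ z, 0 < re z → ∃ C a c a′ r, … ∀ S s, dist s z < r → ∀ h, ‖A S s h‖ ≤ C ‖h‖^a · (e^{−c ‖h‖^{−a′} τ S} · (1 + τ S)^{N_W})`.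
By the desk ruling of record (K2E5-p17 (g8) 2026-09-04T22:15:21Z) the `T`-part `A` is the CONTINUED one, presented place by place through continued local Whittaker
functions; at an archimedean place the continued Whittaker function of a `K_w`-finite flat section obeys the THREE-FACTOR growth of the ★ JUNCTION
`K2LiuKFiniteSectionWhittakerHolomorphyGrowth.kFiniteSection_whittaker_holomorphy_growth`: `‖W_{h′}(s)‖ ≤ C e^{−π tr h′} (1 + tr h′)^N (1 + det h′^{−N′})`, locally
uniformly in `s`, uniformly in the index `h′ > 0`.  Read at the point `h ∈ H(𝔸)` (Iwasawa block `y`, ★ G7 `K2LiuIwasawaHeightLatticeSumBound`) the third factor is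
`1 + |det y|^{−2N′}·|det S|_w^{−N′}`: a DEFECT `|det S|_w^{−N′}` in the archimedean determinant of the index, absent from `hdec`.  It is paid by ARITHMETIC from the
SUPPORT letter: when `A S s h ≠ 0`, `hsupp` gives a denominator `D ≤ C_W ‖h‖^κ` with `D·S` integral; `det S ≠ 0` (KIND W), so `N_{L∕ℚ}(det(D·S))` is a non-zero rational
integer and the product formula bounds every archimedean `|det S|_w` BELOW:
* §2.1 `apply_entry_le_norm`, `apply_det_le` (`|det S|_w ≤ n!·τ^n`), **`inv_apply_det_le`** (`|det S|_w⁻¹ ≤ D^{n([L:ℚ]+1)}·(n!(1+τ)^n)^{[L:ℚ]}`, ★ Mathlib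
  `InfinitePlace.prod_eq_abs_norm`, `Algebra.coe_norm_int`, `IsIntegral.det`, `Matrix.det_le`), `prod_one_add_inv_apply_det_pow_le`;
* §2.3 `defect_pow_le` (real bookkeeping), **`hdec_of_letters`** — generic in the index type `ι` (read `skewMatrices …`, `mat := (↑)`) and the point type `X` (read
  `HA …`, `ht := (↑)`, `N := n + n`): `hτ` (TOP :188–189) + `hdet0` (`A = 0` at `det S = 0`) + `hsupp` (TOP :193–196) + a local decay letter of the TOP's shape TIMES
  `∏_{w∣∞} (1 + |det (mat i)|_w⁻¹)^{N′}` ⟹ `∃ N_W, «hdec bytes»` with `N_W = N₁ + n[L:ℚ]N′#{w∣∞}`, `a ↦ a + κ·n([L:ℚ]+1)N′#{w∣∞}`, `r ↦ min r (re z)` (keeps `re s > 0`).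
[MoeglinWaldspurger1995, II.1.7, IV.1.9], [Shimura1997, §18.4 Prop. 18.14, §A6], [Shimura1982, (1.26), Thm. 3.1], [BorelJacquet1979, §1.2], [NeukirchANT1999, Ch. I §2–§3, Ch. III §1].
HONEST LABEL.  Count-neutral helper, closes no socket: `HC_CM` is proved only modulo the 7 printed citations (2 remaining named inputs: hLiu418 =
`stmt-HodgeConjecture-24832`, h413 = `stmt-HodgeConjecture-24833`) until rung 0 closes.
-/

set_option autoImplicit false
set_option linter.dupNamespace false -- the mandated namespace repeats `HodgeConjecture.HodgeConjecture`

noncomputable section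

namespace Summit.HodgeConjecture.HodgeConjecture.Cruxes.HLiu418.K2LiuSiegelEisensteinKindWDecay

open scoped BigOperators NNReal
-- `Classical` is needed to see the Mathlib normed-ring instances on `mixedSpace L` (note H5 of ★ `AdelicGLnGlue`; as the TOP's `hτ`)
open scoped Classical
open NumberField NumberField.mixedEmbedding NumberField.InfinitePlace IsDedekindDomain
open Literature.NumberTheory.Automorphic

variable (L : Type) [Field L] [NumberField L]

/-! ## §2.0 Why a determinant defect, and how the support letter pays it

The continued archimedean Whittaker function of a `K_w`-finite flat section obeys the THREE-FACTOR growth of the ★ JUNCTION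
`K2LiuKFiniteSectionWhittakerHolomorphyGrowth.kFiniteSection_whittaker_holomorphy_growth`: `‖W_{h′}(s)‖ ≤ C e^{−π tr h′} (1 + tr h′)^N (1 + det h′^{−N′})`, locally
uniformly in `s`, uniformly in the index `h′ > 0`.  Read at the point `h ∈ H(𝔸)` (Iwasawa block `y`, ★ G7) the third factor is `1 + |det y|^{−2N′}·|det S_w|^{−N′}`:
a DEFECT `|det S_w|^{−N′}` in the archimedean determinant of the index, absent from the TOP's `hdec` (:190–192).  It is paid by ARITHMETIC: when `A S s h ≠ 0` the support
letter gives a denominator `D ≤ C_W ‖h‖^κ` with `D·S` integral, so `N_{L∕ℚ}(det(D·S))` is a non-zero rational integer, `∏_w |det S|_w^{m_w} ≥ D^{−n[L:ℚ]}`, and each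
archimedean `|det S|_w` is bounded BELOW by `D^{−n([L:ℚ]+1)} (n!(1+τ S)^n)^{−[L:ℚ]}` (the other places are bounded above by `n!·τ(S)^n`).  Hence
`∏_w (1 + |det S|_w^{−1})^{N′} ≤ C · ‖h‖^{a″} · (1 + τ S)^{N″}` and the defect is absorbed into the TOP's shape with a larger `a` and `N_W`. -/

section ArchFloor

variable {n : ℕ}

/-- **entries at an infinite place are below the mixed sup norm**: `|S_{ab}|_w ≤ ‖(ι_∞ S_{ab})_{ab}‖` (`ι_∞ = mixedEmbedding`, sup norms; ★ Mathlib `norm_eq_sup'_normAtPlace`).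
[cite: NeukirchANT1999, Ch. I §5] -/
theorem apply_entry_le_norm (w : InfinitePlace L) (S : Matrix (Fin n) (Fin n) L) (a b : Fin n) :
    w (S a b) ≤ ‖fun a b => mixedEmbedding L (S a b)‖ := by
  rw [← normAtPlace_apply]
  calc normAtPlace w (mixedEmbedding L (S a b)) ≤ ‖mixedEmbedding L (S a b)‖ := by
        rw [norm_eq_sup'_normAtPlace]
        exact Finset.le_sup' (fun w => normAtPlace w (mixedEmbedding L (S a b))) (Finset.mem_univ w)
    _ ≤ ‖fun b => mixedEmbedding L (S a b)‖ := norm_le_pi_norm (fun b => mixedEmbedding L (S a b)) b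
    _ ≤ ‖fun a b => mixedEmbedding L (S a b)‖ := norm_le_pi_norm (fun a b => mixedEmbedding L (S a b)) a

/-- **`|det S|_w ≤ n! · τ^n`** at every infinite place when the embedded entries are `≤ τ` (Hadamard-free expansion bound, Mathlib `Matrix.det_le` for the absolute value
`‖·‖` of `ℂ`). [cite: Shimura1997, §A3] -/
theorem apply_det_le (w : InfinitePlace L) (S : Matrix (Fin n) (Fin n) L) {τ : ℝ} (hτ : ‖fun a b => mixedEmbedding L (S a b)‖ ≤ τ) :
    w S.det ≤ (n.factorial : ℝ) * τ ^ n := by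
  have hent : ∀ a b, (NormedField.toAbsoluteValue ℂ) ((w.embedding.mapMatrix S) a b) ≤ τ := fun a b => by
    rw [RingHom.mapMatrix_apply, Matrix.map_apply]
    show ‖w.embedding (S a b)‖ ≤ τ
    rw [norm_embedding_eq]
    exact (apply_entry_le_norm L w S a b).trans hτ
  have h := Matrix.det_le (abv := NormedField.toAbsoluteValue ℂ) hent
  rw [Fintype.card_fin, nsmul_eq_mul, ← RingHom.map_det] at h
  rw [← norm_embedding_eq]
  exact h

/-- **THE ARCHIMEDEAN FLOOR OF `det S` FROM A DENOMINATOR.**  `S ∈ M_n(L)` with `det S ≠ 0`, `D ≥ 1` with `D·S_{ab}` integral over `ℤ`, and `‖(ι_∞ S_{ab})‖ ≤ τ`.  Then at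
every infinite place `w` of `L`:  `|det S|_w⁻¹ ≤ D^{n([L:ℚ]+1)} · (n!·(1+τ)^n)^{[L:ℚ]}`.
Proof: `y = D^n det S = det(D·S)` is a non-zero algebraic integer, so `∏_{w′} |y|_{w′}^{m_{w′}} = |N_{L∕ℚ}(y)| ≥ 1` (Mathlib `InfinitePlace.prod_eq_abs_norm`, `Algebra.coe_norm_int`);
every factor is `≤ B := D^n·n!·(1+τ)^n` (`apply_det_le`) and `Σ m_{w′} = [L:ℚ]`, so `|y|_w^{m_w} ≥ B^{−[L:ℚ]}`, whence `|y|_w ≥ B^{−[L:ℚ]}` (`m_w ≥ 1`, `B ≥ 1`) and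
`|det S|_w = D^{−n}|y|_w`. [cite: NeukirchANT1999, Ch. I §2, §5; Ch. III §1 (product formula)] [cite: Shimura1997, §18.4 Prop. 18.14] -/
theorem inv_apply_det_le (S : Matrix (Fin n) (Fin n) L) (hdet : S.det ≠ 0) {D : ℕ} (hD : 1 ≤ D) (hint : ∀ a b, IsIntegral ℤ ((D : L) * S a b))
    {τ : ℝ} (hτ : ‖fun a b => mixedEmbedding L (S a b)‖ ≤ τ) (w : InfinitePlace L) :
    (w S.det)⁻¹ ≤ (D : ℝ) ^ (n * (Module.finrank ℚ L + 1)) * ((n.factorial : ℝ) * (1 + τ) ^ n) ^ Module.finrank ℚ L := by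
  classical
  set d : ℕ := Module.finrank ℚ L with hd
  have hτ0 : 0 ≤ τ := (norm_nonneg _).trans hτ
  have hD0 : (0 : ℝ) < D := by exact_mod_cast hD
  have hD1 : (1 : ℝ) ≤ D := by exact_mod_cast hD
  -- `y = D^n · det S = det (D • S)` is a non-zero algebraic integer
  set y : L := ((D : L)) ^ n * S.det with hy
  have hyS : y = ((D : L) • S).det := by
    rw [hy, Matrix.det_smul, Fintype.card_fin]
  have hyint : IsIntegral ℤ y := by
    rw [hyS]
    exact IsIntegral.det fun a b => by rw [Matrix.smul_apply, smul_eq_mul]; exact hint a b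
  have hy0 : y ≠ 0 := by
    rw [hy]
    exact mul_ne_zero (pow_ne_zero _ (by exact_mod_cast (show D ≠ 0 by omega))) hdet
  -- the product formula: `1 ≤ ∏_{w′} |y|_{w′}^{m_{w′}}`
  have hnorm : (1 : ℝ) ≤ ∏ w' : InfinitePlace L, w' y ^ w'.mult := by
    rw [InfinitePlace.prod_eq_abs_norm]
    set a : 𝓞 L := ⟨y, (mem_integralClosure_iff ℤ L).2 hyint⟩ with ha
    have ha0 : a ≠ 0 := fun h => hy0 (by rw [ha] at h; exact (RingOfIntegers.mk_eq_mk y 0 _ (zero_mem _)).1 (h.trans RingOfIntegers.mk_zero.symm))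
    have hya : y = (a : L) := rfl
    rw [hya, ← Algebra.coe_norm_int, ← Int.cast_one, ← Int.cast_abs, Rat.cast_intCast, Int.cast_le]
    exact Int.one_le_abs (Algebra.norm_ne_zero_iff.mpr ha0)
  -- every factor is `≤ B = D^n · n! · (1+τ)^n`, and `B ≥ 1`
  set B : ℝ := (D : ℝ) ^ n * ((n.factorial : ℝ) * (1 + τ) ^ n) with hB
  have hfac1 : (1 : ℝ) ≤ (n.factorial : ℝ) * (1 + τ) ^ n := by
    have h1 : (1 : ℝ) ≤ n.factorial := by exact_mod_cast Nat.one_le_iff_ne_zero.2 (Nat.factorial_ne_zero n)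
    exact one_le_mul_of_one_le_of_one_le h1 (one_le_pow₀ (by linarith))
  have hB1 : 1 ≤ B := one_le_mul_of_one_le_of_one_le (one_le_pow₀ hD1) hfac1
  have hB0 : 0 ≤ B := zero_le_one.trans hB1
  have hwy : ∀ w' : InfinitePlace L, w' y ≤ B := fun w' => by
    rw [hy, map_mul, map_pow, InfinitePlace.map_natCast, hB]
    refine mul_le_mul_of_nonneg_left ((apply_det_le L w' S (hτ.trans (le_add_of_nonneg_left zero_le_one))).trans le_rfl) (pow_nonneg hD0.le n)
  have hwy0 : ∀ w' : InfinitePlace L, 0 ≤ w' y := fun w' => apply_nonneg _ _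
  -- `|y|_w^{m_w} · B^d ≥ 1`
  have hsplit : ∏ w' : InfinitePlace L, w' y ^ w'.mult = w y ^ w.mult * ∏ w' ∈ Finset.univ.erase w, w' y ^ w'.mult :=
    (Finset.mul_prod_erase Finset.univ (fun w' : InfinitePlace L => w' y ^ w'.mult) (Finset.mem_univ w)).symm
  have hrest : ∏ w' ∈ Finset.univ.erase w, w' y ^ w'.mult ≤ B ^ d := by
    calc ∏ w' ∈ Finset.univ.erase w, w' y ^ w'.mult ≤ ∏ w' ∈ Finset.univ.erase w, B ^ w'.mult :=
          Finset.prod_le_prod (fun w' _ => pow_nonneg (hwy0 w') _) fun w' _ => pow_le_pow_left₀ (hwy0 w') (hwy w') _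
      _ = B ^ ∑ w' ∈ Finset.univ.erase w, w'.mult := Finset.prod_pow_eq_pow_sum _ _ _
      _ ≤ B ^ d := by
          refine pow_le_pow_right₀ hB1 ?_
          rw [hd, ← InfinitePlace.sum_mult_eq (K := L)]
          exact Finset.sum_le_sum_of_subset_of_nonneg (Finset.erase_subset _ _) fun _ _ _ => Nat.zero_le _
  have hmain : 1 ≤ w y ^ w.mult * B ^ d := by
    calc (1 : ℝ) ≤ ∏ w' : InfinitePlace L, w' y ^ w'.mult := hnorm
      _ = w y ^ w.mult * ∏ w' ∈ Finset.univ.erase w, w' y ^ w'.mult := hsplit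
      _ ≤ w y ^ w.mult * B ^ d := mul_le_mul_of_nonneg_left hrest (pow_nonneg (hwy0 w) _)
  -- hence `(B^d)⁻¹ ≤ |y|_w`
  have hBd0 : 0 < B ^ d := pow_pos (lt_of_lt_of_le one_pos hB1) d
  have hpow : (B ^ d)⁻¹ ≤ w y ^ w.mult := by
    rw [inv_le_iff_one_le_mul₀' hBd0]
    simpa [mul_comm] using hmain
  have hwyw : (B ^ d)⁻¹ ≤ w y := by
    by_cases h1 : 1 ≤ w y
    · exact (inv_le_one_of_one_le₀ (one_le_pow₀ hB1)).trans h1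
    · have hle1 : w y ≤ 1 := (not_le.1 h1).le
      have hmono : w y ^ w.mult ≤ w y ^ 1 := pow_le_pow_of_le_one (hwy0 w) hle1 (Nat.one_le_iff_ne_zero.2 InfinitePlace.mult_ne_zero)
      rw [pow_one] at hmono
      exact hpow.trans hmono
  -- `|det S|_w = D^{−n} |y|_w`
  have hyw_pos : 0 < w y := InfinitePlace.pos_iff.2 hy0
  have hinv : (w y)⁻¹ ≤ B ^ d := inv_le_of_inv_le₀ hBd0 hwyw
  have hdetw : w S.det = w y / (D : ℝ) ^ n := by
    rw [hy, map_mul, map_pow, InfinitePlace.map_natCast, mul_div_cancel_left₀ _ (pow_ne_zero _ hD0.ne')]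
  rw [hdetw, inv_div]
  calc (D : ℝ) ^ n / w y = (D : ℝ) ^ n * (w y)⁻¹ := div_eq_mul_inv _ _
    _ ≤ (D : ℝ) ^ n * B ^ d := mul_le_mul_of_nonneg_left hinv (pow_nonneg hD0.le _)
    _ = (D : ℝ) ^ (n + n * d) * ((n.factorial : ℝ) * (1 + τ) ^ n) ^ d := by rw [hB, mul_pow, ← pow_mul, pow_add, mul_assoc]
    _ = (D : ℝ) ^ (n * (d + 1)) * ((n.factorial : ℝ) * (1 + τ) ^ n) ^ d := by rw [show n + n * d = n * (d + 1) by ring]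

/-- **THE ARCHIMEDEAN DETERMINANT DEFECT IS POLYNOMIAL IN THE DENOMINATOR AND IN `1 + τ`**:
`∏_w (1 + |det S|_w⁻¹)^{N′} ≤ (2 · D^{n([L:ℚ]+1)} · (n!(1+τ)^n)^{[L:ℚ]})^{N′ · #{w ∣ ∞}}` (`inv_apply_det_le` at every infinite place; each factor `≤ (2B)^{N′}`, `B ≥ 1`).
[cite: NeukirchANT1999, Ch. III §1] [cite: Shimura1997, §18.4 Prop. 18.14] -/
theorem prod_one_add_inv_apply_det_pow_le (S : Matrix (Fin n) (Fin n) L) (hdet : S.det ≠ 0) {D : ℕ} (hD : 1 ≤ D)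
    (hint : ∀ a b, IsIntegral ℤ ((D : L) * S a b)) {τ : ℝ} (hτ : ‖fun a b => mixedEmbedding L (S a b)‖ ≤ τ) (N' : ℕ) :
    ∏ w : InfinitePlace L, (1 + (w S.det)⁻¹) ^ N' ≤
      (2 * ((D : ℝ) ^ (n * (Module.finrank ℚ L + 1)) * ((n.factorial : ℝ) * (1 + τ) ^ n) ^ Module.finrank ℚ L)) ^
        (N' * Fintype.card (InfinitePlace L)) := by
  set B : ℝ := (D : ℝ) ^ (n * (Module.finrank ℚ L + 1)) * ((n.factorial : ℝ) * (1 + τ) ^ n) ^ Module.finrank ℚ L with hB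
  have hτ0 : 0 ≤ τ := (norm_nonneg _).trans hτ
  have hD1 : (1 : ℝ) ≤ D := by exact_mod_cast hD
  have hfac1 : (1 : ℝ) ≤ (n.factorial : ℝ) * (1 + τ) ^ n := by
    have h1 : (1 : ℝ) ≤ n.factorial := by exact_mod_cast Nat.one_le_iff_ne_zero.2 (Nat.factorial_ne_zero n)
    exact one_le_mul_of_one_le_of_one_le h1 (one_le_pow₀ (by linarith))
  have hB1 : 1 ≤ B := one_le_mul_of_one_le_of_one_le (one_le_pow₀ hD1) (one_le_pow₀ hfac1)
  have hw : ∀ w : InfinitePlace L, (1 + (w S.det)⁻¹) ^ N' ≤ (2 * B) ^ N' := fun w =>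
    pow_le_pow_left₀ (add_nonneg zero_le_one (inv_nonneg.2 (apply_nonneg _ _)))
      (by have h := inv_apply_det_le L S hdet hD hint hτ w; rw [two_mul]; exact add_le_add hB1 h) N'
  calc ∏ w : InfinitePlace L, (1 + (w S.det)⁻¹) ^ N' ≤ ∏ _w : InfinitePlace L, (2 * B) ^ N' :=
        Finset.prod_le_prod (fun w _ => pow_nonneg (add_nonneg zero_le_one (inv_nonneg.2 (apply_nonneg _ _))) _) fun w _ => hw w
    _ = ((2 * B) ^ N') ^ Fintype.card (InfinitePlace L) := by rw [Finset.prod_const, Finset.card_univ]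
    _ = (2 * B) ^ (N' * Fintype.card (InfinitePlace L)) := by rw [← pow_mul]

end ArchFloor

/-! ## §2.3 The TOP's decay letter `hdec` from local letters carrying the determinant defect -/

section Dec

variable {N : ℕ} [NeZero N] {n : ℕ}

/-- **REAL BOOKKEEPING of the absorption**: with `e = n([L:ℚ]+1)`, `d = [L:ℚ]`, `F = n!(1+τ)^n`, `D ≤ C_W · H^κ` (`H > 0`),
`(2 · D^e · F^d)^m ≤ (2^m (n!)^{dm} C_W^{em}) · H^{κ·(em)} · (1+τ)^{n·(dm)}`. [cite: BorelJacquet1979, §1.2] -/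
theorem defect_pow_le {D : ℕ} {CW κ H τ : ℝ} (hH : 0 < H) (hτ : 0 ≤ τ) (hDle : (D : ℝ) ≤ CW * H ^ κ) (d m : ℕ) :
    (2 * ((D : ℝ) ^ (n * (d + 1)) * ((n.factorial : ℝ) * (1 + τ) ^ n) ^ d)) ^ m ≤
      ((2 : ℝ) ^ m * (n.factorial : ℝ) ^ (d * m) * CW ^ (n * (d + 1) * m)) * H ^ (κ * ((n * (d + 1) * m : ℕ) : ℝ)) *
        (1 + τ) ^ (n * (d * m)) := by
  have hD0 : (0 : ℝ) ≤ D := Nat.cast_nonneg D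
  have hDe : (D : ℝ) ^ (n * (d + 1) * m) ≤ CW ^ (n * (d + 1) * m) * H ^ (κ * ((n * (d + 1) * m : ℕ) : ℝ)) := by
    calc (D : ℝ) ^ (n * (d + 1) * m) ≤ (CW * H ^ κ) ^ (n * (d + 1) * m) := pow_le_pow_left₀ hD0 hDle _
      _ = CW ^ (n * (d + 1) * m) * H ^ (κ * ((n * (d + 1) * m : ℕ) : ℝ)) := by
          rw [mul_pow, Real.rpow_mul hH.le, Real.rpow_natCast]
  have hexp : (2 * ((D : ℝ) ^ (n * (d + 1)) * ((n.factorial : ℝ) * (1 + τ) ^ n) ^ d)) ^ m =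
      (2 : ℝ) ^ m * (n.factorial : ℝ) ^ (d * m) * (1 + τ) ^ (n * (d * m)) * (D : ℝ) ^ (n * (d + 1) * m) := by
    ring
  rw [hexp]
  have hK : 0 ≤ (2 : ℝ) ^ m * (n.factorial : ℝ) ^ (d * m) * (1 + τ) ^ (n * (d * m)) := by positivity
  calc (2 : ℝ) ^ m * (n.factorial : ℝ) ^ (d * m) * (1 + τ) ^ (n * (d * m)) * (D : ℝ) ^ (n * (d + 1) * m)
      ≤ (2 : ℝ) ^ m * (n.factorial : ℝ) ^ (d * m) * (1 + τ) ^ (n * (d * m)) * (CW ^ (n * (d + 1) * m) * H ^ (κ * ((n * (d + 1) * m : ℕ) : ℝ))) :=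
        mul_le_mul_of_nonneg_left hDe hK
    _ = ((2 : ℝ) ^ m * (n.factorial : ℝ) ^ (d * m) * CW ^ (n * (d + 1) * m)) * H ^ (κ * ((n * (d + 1) * m : ℕ) : ℝ)) *
        (1 + τ) ^ (n * (d * m)) := by ring

/-- **`hdec` OF THE TOP FROM LOCAL LETTERS CARRYING THE ARCHIMEDEAN DETERMINANT DEFECT** (★ ed. 15 :190–192 shape; generic in the index type `ι` — read
`skewMatrices …`, `mat := (↑)` — and the point type `X` — read `H(𝔸) = HA …`, `ht := (↑)`, `N := n + n`).  For a `T`-part `A : ι → ℂ → X → ℂ` with archimedean size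
`τ` (`hτ`, the TOP's :188–189), vanishing at the degenerate indices (`hdet0`, KIND W lives on `det S ≠ 0`), the SUPPORT letter `hsupp` (TOP :193–196, e.g. from §1
`hsupp_of_local`) and a local decay letter of the TOP's shape TIMES the defect `∏_{w∣∞} (1 + |det S|_w⁻¹)^{N′}` of the three-factor archimedean Whittaker growth (★ JUNCTION
`kFiniteSection_whittaker_holomorphy_growth`, read at the point through ★ G7), THEN `hdec` holds verbatim with `N_W = N₁ + n[L:ℚ]·N′·#{w∣∞}` (`a ↦ a + κ·n([L:ℚ]+1)N′#{w∣∞}`,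
`r ↦ min r (re z)` to keep `re s > 0` for `hsupp`):
`∃ N_W, ∀ z, 0 < re z → ∃ C a c a′ r, … ∧ ∀ i s, dist s z < r → ∀ x, ‖A i s x‖ ≤ C ‖ht x‖^a · (e^{−c ‖ht x‖^{−a′} τ i} (1 + τ i)^{N_W})`.
[cite: MoeglinWaldspurger1995, II.1.7, IV.1.9] [cite: Shimura1997, §18.4 Prop. 18.14] [cite: BorelJacquet1979, §1.2] -/
theorem hdec_of_letters {ι X : Type*} (mat : ι → Matrix (Fin n) (Fin n) L) (ht : X → GL (Fin N) (AdeleRing (𝓞 L) L)) (A : ι → ℂ → X → ℂ)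
    (τ : ι → ℝ) (hτ : ∀ i, ‖fun a b => mixedEmbedding L (mat i a b)‖ ≤ τ i)
    (hdet0 : ∀ (i : ι) (s : ℂ) (x : X), (mat i).det = 0 → A i s x = 0)
    {CW κ : ℝ} (hCW : 0 < CW) (hκ : 0 ≤ κ)
    (hsupp : ∀ (i : ι) (s : ℂ) (x : X), 0 < s.re → A i s x ≠ 0 →
      ∃ D : ℕ, 1 ≤ D ∧ (D : ℝ) ≤ CW * adelicHeightGL N L (ht x) ^ κ ∧ ∀ a b, IsIntegral ℤ ((D : L) * mat i a b))
    (N₁ N' : ℕ)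
    (hloc : ∀ z : ℂ, 0 < z.re → ∃ C a c a' r : ℝ, 0 ≤ C ∧ 0 ≤ a ∧ 0 < c ∧ 0 ≤ a' ∧ 0 < r ∧ ∀ (i : ι) (s : ℂ), dist s z < r → ∀ x : X,
      ‖A i s x‖ ≤ C * adelicHeightGL N L (ht x) ^ a *
        (Real.exp (-(c * adelicHeightGL N L (ht x) ^ (-a') * τ i)) * (1 + τ i) ^ N₁) * ∏ w : InfinitePlace L, (1 + (w (mat i).det)⁻¹) ^ N') :
    ∃ NW : ℕ, ∀ z : ℂ, 0 < z.re → ∃ C a c a' r : ℝ, 0 ≤ C ∧ 0 ≤ a ∧ 0 < c ∧ 0 ≤ a' ∧ 0 < r ∧ ∀ (i : ι) (s : ℂ), dist s z < r → ∀ x : X,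
      ‖A i s x‖ ≤ C * adelicHeightGL N L (ht x) ^ a *
        (Real.exp (-(c * adelicHeightGL N L (ht x) ^ (-a') * τ i)) * (1 + τ i) ^ NW) := by
  set d : ℕ := Module.finrank ℚ L with hd
  set P : ℕ := Fintype.card (InfinitePlace L) with hP
  set m : ℕ := N' * P with hm
  refine ⟨N₁ + n * (d * m), fun z hz => ?_⟩
  obtain ⟨C, a, c, a', r, hC, ha, hc, ha', hr, hb⟩ := hloc z hz
  -- constants: `K₀ = 2^m (n!)^{dm} C_W^{em}`, `a ↦ a + κ·(em)`, `r ↦ min r (re z)`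
  set K₀ : ℝ := (2 : ℝ) ^ m * (n.factorial : ℝ) ^ (d * m) * CW ^ (n * (d + 1) * m) with hK₀
  have hK₀ : 0 ≤ K₀ := by positivity
  refine ⟨C * K₀, a + κ * ((n * (d + 1) * m : ℕ) : ℝ), c, a', min r z.re, mul_nonneg hC hK₀, add_nonneg ha (mul_nonneg hκ (Nat.cast_nonneg _)), hc, ha',
    lt_min hr hz, fun i s hs x => ?_⟩
  have hsr : dist s z < r := lt_of_lt_of_le hs (min_le_left _ _)
  have hs0 : 0 < s.re := by
    have h1 : dist s z < z.re := lt_of_lt_of_le hs (min_le_right _ _)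
    have h2 : |s.re - z.re| ≤ dist s z := by
      rw [Complex.dist_eq, ← Complex.sub_re]
      exact Complex.abs_re_le_norm (s - z)
    have h3 := (abs_lt.1 (lt_of_le_of_lt h2 h1)).1
    linarith
  have hHpos : 0 < adelicHeightGL N L (ht x) := adelicHeightGL_pos_holds (ht x)
  have hτ0 : 0 ≤ τ i := (norm_nonneg _).trans (hτ i)
  -- the main factor of the TOP's shape is non-negative
  have hmain0 : 0 ≤ C * adelicHeightGL N L (ht x) ^ a * (Real.exp (-(c * adelicHeightGL N L (ht x) ^ (-a') * τ i)) * (1 + τ i) ^ N₁) :=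
    mul_nonneg (mul_nonneg hC (Real.rpow_nonneg hHpos.le _)) (mul_nonneg (Real.exp_pos _).le (pow_nonneg (by linarith) _))
  by_cases hA : A i s x = 0
  · rw [hA, norm_zero]
    exact mul_nonneg (mul_nonneg (mul_nonneg hC hK₀) (Real.rpow_nonneg hHpos.le _)) (mul_nonneg (Real.exp_pos _).le (pow_nonneg (by linarith) _))
  -- `det (mat i) ≠ 0` and the denominator of the support letter
  have hdet : (mat i).det ≠ 0 := fun h => hA (hdet0 i s x h)
  obtain ⟨D, hD1, hDle, hDint⟩ := hsupp i s x hs0 hA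
  -- the defect is absorbed
  have hdef : ∏ w : InfinitePlace L, (1 + (w (mat i).det)⁻¹) ^ N' ≤
      K₀ * adelicHeightGL N L (ht x) ^ (κ * ((n * (d + 1) * m : ℕ) : ℝ)) * (1 + τ i) ^ (n * (d * m)) :=
    (prod_one_add_inv_apply_det_pow_le L (mat i) hdet hD1 hDint (hτ i) N').trans (defect_pow_le (n := n) hHpos hτ0 hDle d m)
  calc ‖A i s x‖ ≤ C * adelicHeightGL N L (ht x) ^ a * (Real.exp (-(c * adelicHeightGL N L (ht x) ^ (-a') * τ i)) * (1 + τ i) ^ N₁) *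
        ∏ w : InfinitePlace L, (1 + (w (mat i).det)⁻¹) ^ N' := hb i s hsr x
    _ ≤ C * adelicHeightGL N L (ht x) ^ a * (Real.exp (-(c * adelicHeightGL N L (ht x) ^ (-a') * τ i)) * (1 + τ i) ^ N₁) *
        (K₀ * adelicHeightGL N L (ht x) ^ (κ * ((n * (d + 1) * m : ℕ) : ℝ)) * (1 + τ i) ^ (n * (d * m))) := mul_le_mul_of_nonneg_left hdef hmain0
    _ = C * K₀ * (adelicHeightGL N L (ht x) ^ a * adelicHeightGL N L (ht x) ^ (κ * ((n * (d + 1) * m : ℕ) : ℝ))) *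
        (Real.exp (-(c * adelicHeightGL N L (ht x) ^ (-a') * τ i)) * ((1 + τ i) ^ N₁ * (1 + τ i) ^ (n * (d * m)))) := by ring
    _ = C * K₀ * adelicHeightGL N L (ht x) ^ (a + κ * ((n * (d + 1) * m : ℕ) : ℝ)) *
        (Real.exp (-(c * adelicHeightGL N L (ht x) ^ (-a') * τ i)) * (1 + τ i) ^ (N₁ + n * (d * m))) := by
          rw [← Real.rpow_add hHpos, ← pow_add]

end Dec

end Summit.HodgeConjecture.HodgeConjecture.Cruxes.HLiu418.K2LiuSiegelEisensteinKindWDecay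

end
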